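import Summits.ResolutionOfSingularities.ResolutionOfSingularities.Theorems.EquisingularLiftEquisingularLiftNatNDStrataTowerBaseChange
import Summits.ResolutionOfSingularities.ResolutionOfSingularities.Theorems.EquisingularLiftEquisingularLiftNatNDChartPlays
import Summits.ResolutionOfSingularities.ResolutionOfSingularities.Theorems.EquisingularLiftEquisingularLiftNatNDFrameChartFlat
import Summits.ResolutionOfSingularities.ResolutionOfSingularities.Theorems.EquisingularLiftEquisingularLiftNatNDRoundModelSplit
import Summits.ResolutionOfSingularities.ResolutionOfSingularities.Theorems.EquisingularLiftEquisingularLiftNatNDModelStepFrame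
import Literature.AlgebraicGeometry.Resolution.BlowupsFlatBaseChange
import Literature.AlgebraicGeometry.Resolution.BlowupDisjointCentreSplitting
import Literature.AlgebraicGeometry.Resolution.PermissibleCentres
import Mathlib.AlgebraicGeometry.Morphisms.Flat
import Mathlib.AlgebraicGeometry.Morphisms.FiniteType
import Mathlib.RingTheory.Ideal.KrullsHeightTheorem
import HarnessLib

/-!
# [OURS · L1 W4.5(b) · EL♮(3) · ND-K5] (B4β1) `transportStep : ND.TransportStep n k` — ONE LINKED STEP of the (B4β) étale/flat transport, BY NAME
# against SPEC v11 §13.15 (`Cruxes/EquisingularLiftNatThree/NewtonNondegenerateRungK5.lean` a5493418881edb4c) / the tree port `…NatNDRoundModelSplit`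

OURS · L1 W4.5(b) · EL♮(3) stmt-ResolutionOfSingularities-20148 (parent EL♮ stmt-…-20038) · counted 0 · AI-written (res-L1-w45b-nose-w2 g0, WIDTH seat on D-0157 DOOR 1;
desk WIDTH TABLE D1′ row nose-w2 = (B4β1)), weaker than expert review; nothing of [Hironaka2017] asserted; no statement of the manuscript; resolution in positive
characteristic is NOT proved here or anywhere in this cell. PROVED plumbing + the brick (no `sorry`, no new definition, no instance, no notation; standard axioms).
`--supports stmt-ResolutionOfSingularities-20148 --as helper`.

WHAT. §1 plumbing: points / ranges of cartesian squares, «iso off `x`» through a blow-up whose centre lies over `x`, bookkeeping of the strict-transform set off `x`,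
`T₁ ⊄ {x}` from the frame data `(w) = 𝔪_x`, `dim = n ≥ 2`, `g(0) = 0`, `𝓘_{cl T₁,x} = (g(w))` (Krull's
`ringKrullDim_le_spanFinrank_maximalIdeal`), flatness of the frame base map at scheme level (res-L1-w45b-iso-w2's `ND.flat_frameChart` p642337), `LocallyOfFiniteType φA` /
`IsLocallyNoetherian A` from the 𝔸ⁿ-charts of (TS1). §2 THE BRICK `transportStep` over `…NatNDStrataTowerBaseChange` (p643225: `stratum_comap`, `stepAlong_comap_of_flat`,
`preimage_closure_preimage_diff_of_flat`, …), `IsBlowup.of_isPullback_of_flat` / `pullback_snd_of_flat` / `unique` / `isLocallyNoetherian`, `flat_fromSpecStalk`.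
-/

set_option linter.dupNamespace false

noncomputable section

open CategoryTheory CategoryTheory.Limits AlgebraicGeometry TopologicalSpace Topology
open Literature.AlgebraicGeometry.Resolution
open AlgebraicGeometry.Scheme.IdealSheafData

namespace Summit.ResolutionOfSingularities.ResolutionOfSingularities.Cruxes.EquisingularLiftNat.Sections.ND

variable {n : ℕ}

/-! ## §1 Plumbing for (B4β1) `transportStep` -/

/-- Points of a cartesian square: over a pair of points with the same image there is a point of the fibre product (any `IsPullback` square;
Mathlib's `Scheme.Pullback.exists_preimage_pullback` transported along `IsPullback.isoPullback`). [folklore] -/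
theorem exists_preimage_of_isPullback {P X Y Z : Scheme.{0}} {fst : P ⟶ X} {snd : P ⟶ Y} {f : X ⟶ Z} {g : Y ⟶ Z}
    (H : IsPullback fst snd f g) (x : X) (y : Y) (h : f x = g y) : ∃ p : P, fst p = x ∧ snd p = y := by
  obtain ⟨z, hz1, hz2⟩ := Scheme.Pullback.exists_preimage_pullback (f := f) (g := g) x y h
  refine ⟨H.isoPullback.inv z, ?_, ?_⟩
  · rw [← Scheme.Hom.comp_apply, H.isoPullback_inv_fst, hz1]
  · rw [← Scheme.Hom.comp_apply, H.isoPullback_inv_snd, hz2]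

/-- The range of the first projection of a cartesian square is the preimage of the range of the base map. [folklore] -/
theorem range_fst_of_isPullback {P X Y Z : Scheme.{0}} {fst : P ⟶ X} {snd : P ⟶ Y} {f : X ⟶ Z} {g : Y ⟶ Z}
    (H : IsPullback fst snd f g) : Set.range fst = f ⁻¹' Set.range g := by
  ext x
  constructor
  · rintro ⟨p, rfl⟩
    exact ⟨snd p, by rw [← Scheme.Hom.comp_apply, ← H.w, Scheme.Hom.comp_apply]⟩
  · rintro ⟨y, hy⟩
    obtain ⟨p, hp, -⟩ := exists_preimage_of_isPullback H x y hy.symm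
    exact ⟨p, hp⟩

/-- If `f` restricts to an isomorphism over the open `U`, every point of `U` is hit by `f`. [folklore] -/
theorem exists_eq_of_isIso_morphismRestrict {X Y : Scheme.{0}} (f : X ⟶ Y) (U : Y.Opens) [IsIso (f ∣_ U)] {y : Y} (hy : y ∈ U) :
    ∃ x : X, f x = y := by
  have hsurj : Function.Surjective (f ∣_ U) := (ConcreteCategory.bijective_of_isIso (f ∣_ U).base).2
  obtain ⟨v, hv⟩ := hsurj ⟨y, hy⟩
  refine ⟨v.1, ?_⟩
  have := morphismRestrict_base_coe f U v
  rw [hv] at this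
  exact this.symm

/-- Passing a blow-up whose centre lies over `x` keeps «iso off `x`»: if `φ ∣_ {x}ᶜ` is an isomorphism, `υ` is a blow-up along `C` and `supp C ⊆ φ⁻¹{x}`, then
`(υ ≫ φ) ∣_ {x}ᶜ` is an isomorphism (`IsBlowup.isIso_morphismRestrict` + `morphismRestrict_comp`). [folklore] -/
theorem isIso_morphismRestrict_comp_of_isBlowup {F₁ F F' : Scheme.{0}} (φ : F ⟶ F₁) (U : F₁.Opens) [IsIso (φ ∣_ U)]
    {C : F.IdealSheafData} {υ : F' ⟶ F} (hυ : IsBlowup υ C) (hC : (C.support : Set F) ⊆ φ ⁻¹' (U : Set F₁)ᶜ) :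
    IsIso ((υ ≫ φ) ∣_ U) := by
  haveI h1 : IsIso (υ ∣_ φ ⁻¹ᵁ U) := hυ.isIso_morphismRestrict (by
    rw [Set.disjoint_right]
    intro c hc hcU
    exact hC hc hcU)
  have h2 : IsIso (υ ∣_ φ ⁻¹ᵁ U ≫ φ ∣_ U) := IsIso.comp_isIso
  rw [morphismRestrict_comp]
  exact h2

/-- Bookkeeping of the strict-transform SET through one blow-up whose centre `D` lies over `x`: if `TF ∩ φ⁻¹{x}ᶜ = φ⁻¹(T₁ ∖ {x})`, `TF` closed and `D ⊆ φ⁻¹{x}`,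
then `cl(υ⁻¹(TF ∖ D)) ∩ (υ ≫ φ)⁻¹{x}ᶜ = (υ ≫ φ)⁻¹(T₁ ∖ {x})`. [folklore] -/
theorem closure_preimage_diff_inter_eq {F₁ F F' : Scheme.{0}} (φ : F ⟶ F₁) (x : F₁) (T₁ : Set F₁) {TF D : Set F} (hTF : IsClosed TF)
    (hD : D ⊆ φ ⁻¹' {x}) (hbook : TF ∩ φ ⁻¹' {x}ᶜ = φ ⁻¹' (T₁ \ {x})) (υ : F' ⟶ F) :
    closure (υ ⁻¹' (TF \ D)) ∩ (υ ≫ φ) ⁻¹' {x}ᶜ = (υ ≫ φ) ⁻¹' (T₁ \ {x}) := by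
  ext z
  simp only [Set.mem_inter_iff, Set.mem_preimage, Set.mem_compl_iff, Set.mem_singleton_iff, Set.mem_sdiff, Scheme.Hom.comp_apply]
  constructor
  · rintro ⟨hz, hzx⟩
    have hzT : υ z ∈ TF := by
      have : closure (υ ⁻¹' (TF \ D)) ⊆ υ ⁻¹' TF :=
        closure_minimal (Set.preimage_mono Set.sdiff_subset) (hTF.preimage υ.continuous)
      exact this hz
    have : υ z ∈ TF ∩ φ ⁻¹' {x}ᶜ := ⟨hzT, hzx⟩
    rw [hbook] at this
    exact this
  · rintro ⟨hzT, hzx⟩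
    have hmem : υ z ∈ TF ∩ φ ⁻¹' {x}ᶜ := by
      rw [hbook]
      exact ⟨hzT, hzx⟩
    refine ⟨subset_closure ?_, hzx⟩
    exact ⟨hmem.1, fun hzD => hzx (hD hzD)⟩

/-- In the frame data of `TransportRound`: with `n ≥ 2`, `(w) = 𝔪_x`, `dim 𝒪_{F₁,x} = n`, `𝒪_{F₁,x}` Noetherian, `g(0) = 0` and `𝓘_{cl T₁, x} = (g(w))`, the closed
set `T₁` is NOT inside `{x}` (else `(g(w))` would be `⊤` — but `g(w) ∈ 𝔪_x` — or `𝔪_x` — but then `dim ≤ 1` by Krull). [OURS · plumbing] -/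
theorem not_subset_singleton_of_frame {F₁ : Scheme.{0}} {k : Type} [Field k] (ρ : F₁ ⟶ (Literature.AlgebraicGeometry.Motives.projectiveSpace n k).left)
    {T₁ : Set F₁} {x : F₁} (hx : IsClosed ({x} : Set F₁)) [IsNoetherianRing (F₁.presheaf.stalk x)]
    (w : Fin n → F₁.presheaf.stalk x) (g : MvPolynomial (Fin n) k) (hn : 2 ≤ n)
    (h2 : Ideal.span (Set.range w) = IsLocalRing.maximalIdeal (F₁.presheaf.stalk x))
    (h3 : ringKrullDim (F₁.presheaf.stalk x) = (n : WithBot ℕ∞)) (hg0 : MvPolynomial.constantCoeff g = 0)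
    (h5 : stalkIdeal (vanishingIdeal (⟨closure T₁, isClosed_closure⟩ : Closeds F₁)) x =
      Ideal.span {MvPolynomial.eval₂ (baseToStalk n k ρ x) w g}) :
    ¬ T₁ ⊆ {x} := by
  intro hsub
  have hcl : closure T₁ ⊆ {x} := hx.closure_subset_iff.mpr hsub
  -- `g(w) ∈ 𝔪_x`
  have hgw : MvPolynomial.eval₂ (baseToStalk n k ρ x) w g ∈ IsLocalRing.maximalIdeal (F₁.presheaf.stalk x) := by
    rw [← h2, show MvPolynomial.eval₂ (baseToStalk n k ρ x) w g = MvPolynomial.eval₂Hom (baseToStalk n k ρ x) w g from rfl,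
      MvPolynomial.as_sum g, map_sum]
    refine Ideal.sum_mem _ fun d hd => ?_
    rw [MvPolynomial.eval₂Hom_monomial]
    have hd0 : d ≠ 0 := by
      rintro rfl
      rw [MvPolynomial.mem_support_iff] at hd
      exact hd hg0
    obtain ⟨i, hi⟩ := Finsupp.ne_iff.mp hd0
    refine Ideal.mul_mem_left _ _ ?_
    rw [Finsupp.prod, ← Finset.prod_erase_mul _ _ (Finsupp.mem_support_iff.mpr hi)]
    exact Ideal.mul_mem_left _ _ (Ideal.pow_mem_of_mem _ (Ideal.subset_span (Set.mem_range_self i)) _ (Nat.pos_of_ne_zero hi))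
  by_cases hxT : x ∈ closure T₁
  · -- `cl T₁ = {x}`: the stalk of its ideal at `x` is `𝔪_x`, which would be principal
    have heq : closure T₁ = {x} := Set.Subset.antisymm hcl (Set.singleton_subset_iff.mpr hxT)
    have hmax : stalkIdeal (vanishingIdeal (⟨closure T₁, isClosed_closure⟩ : Closeds F₁)) x =
        IsLocalRing.maximalIdeal (F₁.presheaf.stalk x) := by
      have : (⟨closure T₁, isClosed_closure⟩ : Closeds F₁) = ⟨{x}, hx⟩ := Closeds.ext heq
      rw [this]
      exact stalkIdeal_vanishingIdeal_singleton hx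
    rw [hmax] at h5
    have hle := ringKrullDim_le_spanFinrank_maximalIdeal (F₁.presheaf.stalk x)
    rw [h3, h5] at hle
    have h1 : (Ideal.span {MvPolynomial.eval₂ (baseToStalk n k ρ x) w g}).spanFinrank ≤ 1 :=
      (Submodule.spanFinrank_span_le_ncard_of_finite (Set.finite_singleton _)).trans (by simp)
    have : (n : WithBot ℕ∞) ≤ (1 : ℕ) := hle.trans (by exact_mod_cast h1)
    have : n ≤ 1 := by exact_mod_cast this
    omega
  · -- `x ∉ cl T₁`: then `cl T₁ = ∅`, the ideal is `⊤`, and `g(w)` would be a unit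
    have hempty : closure T₁ = ∅ := by
      ext y
      simp only [Set.mem_empty_iff_false, iff_false]
      intro hy
      exact hxT (hcl hy ▸ hy)
    have htop : (vanishingIdeal (⟨closure T₁, isClosed_closure⟩ : Closeds F₁) : F₁.IdealSheafData) = ⊤ := by
      rw [← support_eq_bot_iff]  -- support of vanishingIdeal of a closed set is that set
      ext y
      simp [Scheme.IdealSheafData.coe_support_vanishingIdeal, hempty]
    rw [htop, stalkIdeal_top] at h5
    have hunit : IsUnit (MvPolynomial.eval₂ (baseToStalk n k ρ x) w g) := by
      rw [← Ideal.span_singleton_eq_top, ← h5]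
    exact (IsLocalRing.maximalIdeal.isMaximal _).ne_top (Ideal.eq_top_of_isUnit_mem _ hgw hunit)

/-- **The frame base map `Spec 𝒪_{F₁,x} ⟶ 𝔸ⁿ_k`, `t ↦ w`, is FLAT** — res-L1-w45b-iso-w2's `ND.flat_frameChart` (p642337) at scheme level. [OURS · plumbing] -/
theorem flat_specMap_frameChart (k : Type) [Field k] {F₁ : Scheme.{0}}
    (ρ : F₁ ⟶ (Literature.AlgebraicGeometry.Motives.projectiveSpace n k).left) (x : F₁)
    [IsNoetherianRing (F₁.presheaf.stalk x)] (w : Fin n → F₁.presheaf.stalk x)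
    (hw : Ideal.span (Set.range w) = IsLocalRing.maximalIdeal (F₁.presheaf.stalk x))
    (hdim : ringKrullDim (F₁.presheaf.stalk x) = (n : WithBot ℕ∞)) :
    Flat (Spec.map (CommRingCat.ofHom (MvPolynomial.eval₂Hom (baseToStalk n k ρ x) w))) := by
  rw [HasRingHomProperty.Spec_iff (P := @Flat), CommRingCat.hom_ofHom]
  exact flat_frameChart n k F₁ ρ x w hw hdim

/-- A morphism to `𝔸ⁿ_k` that is, on an open cover by copies of `𝔸ⁿ_k`, given by `k`-algebra endomorphisms of `k[t]` is LOCALLY OF FINITE TYPE (the chart clause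
(TS1) of `ND.ToricStage`). [OURS · plumbing] -/
theorem locallyOfFiniteType_of_affineCharts (k : Type) [Field k] {A : Scheme.{0}} (φ : A ⟶ Aff n k)
    (h : ∀ a : A, ∃ (c : Aff n k ⟶ A) (ψ : MvPolynomial (Fin n) k →ₐ[k] MvPolynomial (Fin n) k),
      IsOpenImmersion c ∧ a ∈ Set.range c ∧ c ≫ φ = Spec.map (CommRingCat.ofHom ψ.toRingHom)) :
    LocallyOfFiniteType φ := by
  choose c ψ hc ha hcφ using h
  let 𝒰 : A.OpenCover := Scheme.Cover.mkOfCovers A (fun _ => Aff n k) c (fun a => ⟨a, ha a⟩) (fun a => hc a)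
  refine (IsZariskiLocalAtSource.iff_of_openCover (P := @LocallyOfFiniteType) 𝒰).mpr ?_
  intro (a : A)
  change LocallyOfFiniteType (c a ≫ φ)
  rw [hcφ a, HasRingHomProperty.Spec_iff (P := @LocallyOfFiniteType), CommRingCat.hom_ofHom]
  refine RingHom.FiniteType.of_comp_finiteType (f := algebraMap k (MvPolynomial (Fin n) k)) ?_
  have hcomp : (ψ a).toRingHom.comp (algebraMap k (MvPolynomial (Fin n) k)) = algebraMap k (MvPolynomial (Fin n) k) :=
    RingHom.ext fun r => (ψ a).commutes r
  rw [hcomp]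
  exact RingHom.finiteType_algebraMap.mpr inferInstance

/-- A scheme with an open cover by copies of `𝔸ⁿ_k` is locally Noetherian. [OURS · plumbing] -/
theorem isLocallyNoetherian_of_affineCharts (k : Type) [Field k] {A : Scheme.{0}}
    (h : ∀ a : A, ∃ c : Aff n k ⟶ A, IsOpenImmersion c ∧ a ∈ Set.range c) : IsLocallyNoetherian A := by
  choose c hc ha using h
  let 𝒰 : A.OpenCover := Scheme.Cover.mkOfCovers A (fun _ => Aff n k) c (fun a => ⟨a, ha a⟩) (fun a => hc a)
  refine (isLocallyNoetherian_iff_openCover 𝒰).mpr fun _ => ?_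
  change IsLocallyNoetherian (Aff n k)
  infer_instance

section RoundModel

variable (n : ℕ) (k : Type) [Field k]

/-! ## §2 (B4β1) THE BRICK -/

/-- **(B4β1) `transportStep` — ONE LINKED STEP of the (B4β) transport** (SPEC v11 §13.15 `ND.TransportStep`, closed BY NAME): at an F-stage linked over
`Spec 𝒪_{F₁,x}` to a model toric stage, a model move is F-legal, and any blow-up of the F-side stratum gives the next F-stage, linked to the model's next stage.
PROOF. Instances: `a` flat (base change of `fromSpecStalk`, `flat_fromSpecStalk`), `b` flat (base change of the frame base map, res-L1-w45b-iso-w2's `ND.flat_frameChart`),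
`L` locally Noetherian (`φA` is locally of finite type by the 𝔸ⁿ-charts of (TS1), so `c : L ⟶ Spec 𝒪_{F₁,x}` is). The three centres `C_F`, `C_A`, `C_L = C_F·𝒪_L = C_A·𝒪_L`
(`stratum_comap` + the link). F-LEGALITY: `supp C_F ⊆ φF⁻¹{x} ⊆ range a` (a non-frame ray of `τ`, `FStage`, `x = fromSpecStalk x (closed point)`), so `hE1` transfers through
`L` from the model; `hT`: (TS0) + the non-frame ray force `n ≥ 2` (res-L1-w45b-iso-w1's `two_le_of_exists_notMem_range_e`, p643682), hence `T₁ ⊄ {x}` (`not_subset_singleton_of_frame`: `(g(w))` is neither `⊤` nor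
`𝔪_x`), and the iso off `x` produces a point of `TF` off `φF⁻¹{x} ⊇ supp C_F`. NEW F-STAGE: `IsBlowup.isLocallyNoetherian`, `isIso_morphismRestrict_comp_of_isBlowup`,
`closure_preimage_diff_inter_eq`, supports of the stepped boundary over `x`. NEW LINK: `L' := L ×_F F'` is the blow-up of `C_L` (flat base change, GW 13.91 (2)), and so is
`L ×_A A'`; uniqueness of blow-ups identifies them over `L`, giving both cartesian squares by pasting; boundaries by `stepAlong_comap_of_flat` on both squares, `T`'s by
`preimage_closure_preimage_diff_of_flat` on both squares. The binder `[IsAlgClosed k]` is the SPEC's (v11 l.721) and is NOT used by the proof. [OURS · L1 W4.5b · (B4β1)] -/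
theorem transportStep [IsAlgClosed k] : TransportStep n k := by
  intro F₁ ρ T₁ hreg hF₁ hT₁ x hx W w g h1 h2 h3 h4 h5 Φ F φF EF TF A φA EA TA hFS hL hTS σ hσ τ hτσ hBad hτ hfresh hE1A hTA
    A' υA hυA hTS'
  obtain ⟨hFn, hiso, hbook, hTFcl, hEFx⟩ := hFS
  obtain ⟨L, a, b, c, Ha, Hb, hEab, hTab⟩ := hL
  obtain ⟨hTS0, hcharts, -, -, hTAcl, -⟩ := hTS
  obtain ⟨-, hcharts', -, -, -, -⟩ := hTS'
  haveI := hF₁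
  haveI := hFn
  haveI := hiso
  haveI : IsRegularLocalRing (F₁.presheaf.stalk x) := hreg x
  -- flatness of the two legs of the link
  haveI : Flat (F₁.fromSpecStalk x) := flat_fromSpecStalk F₁ x
  haveI : Flat a := MorphismProperty.of_isPullback Ha.flip ‹Flat (F₁.fromSpecStalk x)›
  haveI : Flat (frameBaseMap n k ρ x w) := by
    unfold frameBaseMap
    exact flat_specMap_frameChart k ρ x w h2 h3
  haveI : Flat b := MorphismProperty.of_isPullback Hb.flip ‹Flat (frameBaseMap n k ρ x w)›
  -- the model stages are locally Noetherian and `φA` is locally of finite type (𝔸ⁿ-charts), so `L` is locally Noetherian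
  haveI : IsLocallyNoetherian A := isLocallyNoetherian_of_affineCharts k
    (fun y => by obtain ⟨_, _, _, c', hc', hy, -⟩ := hcharts y; exact ⟨c', hc', hy⟩)
  haveI : IsLocallyNoetherian A' := isLocallyNoetherian_of_affineCharts k
    (fun y => by obtain ⟨_, _, _, c', hc', hy, -⟩ := hcharts' y; exact ⟨c', hc', hy⟩)
  haveI : LocallyOfFiniteType φA := locallyOfFiniteType_of_affineCharts k φA
    (fun y => by
      obtain ⟨_, _, B, c', hc', hy, -, -, hcφ, -⟩ := hcharts y
      exact ⟨c', MvPolynomial.aeval fun l => ∏ i, (MvPolynomial.X i : MvPolynomial (Fin n) k) ^ B i l, hc', hy, hcφ⟩)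
  haveI : LocallyOfFiniteType c := MorphismProperty.of_isPullback Hb ‹LocallyOfFiniteType φA›
  haveI : IsLocallyNoetherian L := LocallyOfFiniteType.isLocallyNoetherian c
  -- the three centres
  have hEabF : (fun ρ => (EF ρ).comap a) = (fun ρ => (EA ρ).comap b) := funext hEab
  have hCab : (stratum EF τ).comap a = (stratum EA τ).comap b := by
    rw [← stratum_comap, ← stratum_comap, hEabF]
  have hsuppab : a ⁻¹' ((stratum EF τ).support : Set F) = b ⁻¹' ((stratum EA τ).support : Set A) := by
    rw [← coe_support_stratum_comap, ← coe_support_stratum_comap, hEabF]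
  -- the centre lies over `x`, hence inside the image of `a`
  obtain ⟨ρ₀, hρ₀τ, hρ₀⟩ := hτ
  have hCFx : ((stratum EF τ).support : Set F) ⊆ φF ⁻¹' {x} := (coe_support_stratum_subset EF hρ₀τ).trans (hEFx ρ₀ hρ₀)
  have hCF_range : ((stratum EF τ).support : Set F) ⊆ Set.range a := by
    intro y hy
    rw [range_fst_of_isPullback Ha, Set.mem_preimage, (hCFx hy : φF y = x)]
    exact ⟨IsLocalRing.closedPoint _, Scheme.fromSpecStalk_closedPoint⟩
  -- (1) F-legality
  have hE1F : ((stratum EF τ).support : Set F) ⊆ TF := by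
    intro y hy
    obtain ⟨l, rfl⟩ := hCF_range hy
    have hl : l ∈ a ⁻¹' ((stratum EF τ).support : Set F) := hy
    rw [hsuppab] at hl
    have hl' : l ∈ b ⁻¹' TA := hE1A hl
    rw [← hTab] at hl'
    exact hl'
  have hn : 2 ≤ n := two_le_of_exists_notMem_range_e (hTS0 σ hσ) hτσ ⟨ρ₀, hρ₀τ, hρ₀⟩
  have hT₁x : ¬ T₁ ⊆ {x} := not_subset_singleton_of_frame ρ hx w g hn h2 h3 h4.1.1.1 h5
  have hTF : ¬ TF ⊆ ((stratum EF τ).support : Set F) := by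
    intro hsub
    apply hT₁x
    intro y hy
    by_contra hyx
    obtain ⟨z, hz⟩ := exists_eq_of_isIso_morphismRestrict φF (⟨{x}ᶜ, hx.isOpen_compl⟩ : F₁.Opens) (y := y) hyx
    have hz' : z ∈ φF ⁻¹' (T₁ \ {x}) := by
      rw [Set.mem_preimage, hz]
      exact ⟨hy, hyx⟩
    rw [← hbook] at hz'
    exact hz'.2 (hCFx (hsub hz'.1))
  refine ⟨⟨hE1F, hTF⟩, fun F' υF hυF => ?_⟩
  haveI : IsLocallyNoetherian F' := hυF.isLocallyNoetherian
  -- (2a) the new F-stage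
  have hFS' : FStage n F₁ x hx T₁ F' (υF ≫ φF) (EF.stepAlong (stratum EF τ) (∑ ρ ∈ τ, ρ) υF)
      (closure (υF ⁻¹' (TF \ ((stratum EF τ).support : Set F)))) := by
    refine ⟨inferInstance, ?_, closure_preimage_diff_inter_eq φF x T₁ hTFcl hCFx hbook υF, isClosed_closure, ?_⟩
    · exact isIso_morphismRestrict_comp_of_isBlowup φF _ hυF (fun y hy => by
        show φF y ∈ (({x}ᶜ : Set F₁))ᶜ
        rw [compl_compl]
        exact hCFx hy)
    · intro ρ hρ
      by_cases hν : ρ = ∑ ρ ∈ τ, ρ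
      · rw [hν, stepAlong_self, support_comap]
        intro z hz
        show (υF ≫ φF) z ∈ ({x} : Set F₁)
        rw [Scheme.Hom.comp_apply]
        exact hCFx hz
      · rw [stepAlong_of_ne _ _ hν]
        have hle : ((strictTransformIdeal υF (stratum EF τ) (EF ρ)).support : Set F') ⊆ (((EF ρ).comap υF).support : Set F') :=
          support_antitone (comap_le_strictTransformIdeal υF (stratum EF τ) (EF ρ))
        refine hle.trans ?_
        rw [support_comap]
        intro z hz
        show (υF ≫ φF) z ∈ ({x} : Set F₁)
        rw [Scheme.Hom.comp_apply]
        exact hEFx ρ hρ hz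
  -- (2b) the new link: `L' := L ×_F F'`, the blow-up of `C_L`, compared with `L ×_A A'`
  have H1 : IsPullback (pullback.fst υF a) (pullback.snd υF a) υF a := IsPullback.of_hasPullback υF a
  haveI : Flat (pullback.fst υF a) := MorphismProperty.of_isPullback H1.flip ‹Flat a›
  have hυL : IsBlowup (pullback.snd υF a) ((stratum EF τ).comap a) := hυF.of_isPullback_of_flat H1
  haveI : IsLocallyNoetherian (pullback υF a : Scheme.{0}) := hυL.isLocallyNoetherian
  have hPA : IsBlowup (pullback.snd υA b) ((stratum EF τ).comap a) := by
    rw [hCab]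
    exact hυA.pullback_snd_of_flat b
  obtain ⟨eI, he, -⟩ := hυL.unique hPA
  have H2 : IsPullback (eI.hom ≫ pullback.fst υA b) (pullback.snd υF a) υA b := by
    refine IsPullback.of_iso_pullback ⟨?_⟩ eI rfl he
    rw [Category.assoc, pullback.condition, ← Category.assoc, he]
  haveI : Flat (eI.hom ≫ pullback.fst υA b) := MorphismProperty.of_isPullback H2.flip ‹Flat b›
  refine ⟨hFS', pullback υF a, pullback.fst υF a, eI.hom ≫ pullback.fst υA b, pullback.snd υF a ≫ c,
    H1.paste_vert Ha, H2.paste_vert Hb, fun ρ => ?_, ?_⟩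
  · have hF' := congrFun (stepAlong_comap_of_flat EF (stratum EF τ) (∑ ρ ∈ τ, ρ) υF a (pullback.fst υF a) (pullback.snd υF a) H1.w) ρ
    have hA' := congrFun (stepAlong_comap_of_flat EA (stratum EA τ) (∑ ρ ∈ τ, ρ) υA b (eI.hom ≫ pullback.fst υA b) (pullback.snd υF a) H2.w) ρ
    rw [hF', hA', hEabF, ← stratum_comap, ← stratum_comap, hEabF]
  · rw [preimage_closure_preimage_diff_of_flat H1.w hTFcl (stratum EF τ).support.isClosed,
      preimage_closure_preimage_diff_of_flat H2.w hTAcl (stratum EA τ).support.isClosed, hTab, hsuppab]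

end RoundModel

end Summit.ResolutionOfSingularities.ResolutionOfSingularities.Cruxes.EquisingularLiftNat.Sections.ND

end
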